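import Summits.NavierStokesRegularity.NavierStokesRegularity.Theorems.ExtremiserTransienceNearExtremalTransienceExtremiserLiouvilleConstantSpeedBlowDownWeakLimit
import HarnessLib

/-!
# Crux `ExtremiserTransience.NearExtremalTransience` (stmt-NavierStokesRegularity-21883), line `extremiser_liouville`,
# stub K1b — NO STRONG CONVERGENCE OF BLOW-DOWNS ON ANY ENERGY-CARRYING WINDOW (the (β)-ready kill)

`--supports stmt-NavierStokesRegularity-21883` (helper).  Author: prover seat `ns-el-k1b` (g6).  The form of the blow-down kill that
record §8 case (β) consumes: let `(v, μ)` be a K1b residue (general frame), `Rₙ → ∞`, and let `U` be a pairings-limit of the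
blow-downs `Vₙ = Rₙ(v(Rₙ·) − c)` (e.g. a weak `L²_loc` limit along a subsequence) with sub-cubic growth `∫_{B_L}‖U‖² ≤ C L^θ`.  Then
`U = 0` (`blowDown_weakLimit_ae_eq_zero`), so on NO measurable window `K` carrying energy `∫⁻_K ‖Vₙ‖ₑ² ≥ e₀ > 0` can `Vₙ → U`
strongly in `L²(K)`.  In case (β) (`∫_{|x|∼R}‖DV‖² = O(R⁻¹)`, Rellich off the origin) the window `K = {1 ≤ |y·ĉ| ≤ 2, |y_h| ≤ 1}`
of a sub-conical jet carries the energy `E₀` and the convergence there IS strong — contradiction; so after this file (β) needs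
only its `H¹_loc` bound.

* `blowDown_not_stronglyConvergent_on` : the statement above.

WHAT THIS IS NOT: K1b is NOT proved; nothing here proves NS regularity. [folklore]
-/

noncomputable section

open Set Filter Topology MeasureTheory Metric Function
open scoped ENNReal NNReal Topology InnerProductSpace RealInnerProductSpace ContDiff
open Literature.Analysis.FluidPDE Literature.Analysis

namespace Summit.NavierStokesRegularity.NavierStokesRegularity.Theorems

-- the problem directory repeats the summit name (`NavierStokesRegularity/NavierStokesRegularity`)
set_option linter.dupNamespace false

namespace ExtremiserLiouville

open DepletionLadder.KStar DepletionLadder.KStar.HalfSpace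

variable {v : E3 → E3} {c : E3}

/-- **No strong convergence of blow-downs on an energy-carrying window.**  Residue `(v, μ)` as in
`blowDown_weakLimit_ae_eq_zero`; `Rₙ ≥ 1`, `Rₙ → ∞`; `U` locally integrable with the pairings of `Vₙ = Rₙ(v(Rₙ·) − c)` converging
to those of `U` and `∫⁻_{B_L}‖U‖ₑ² ≤ C L^θ` (`L ≥ 1`, `θ < 3`); `K` measurable with `∫⁻_K ‖Vₙ‖ₑ² ≥ e₀ > 0` for all `n`.  Then
`∫⁻_K ‖Vₙ − U‖ₑ² ↛ 0`.  (K1b itself is NOT proved here.) [folklore] -/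
theorem blowDown_not_stronglyConvergent_on (hv : ContDiff ℝ ∞ v) (hdiv : VectorCalculus.IsDivFree v) {M : ℝ}
    (hM : ∀ x, ‖v x‖ = M) (h1 : ∫⁻ x, ‖iteratedFDeriv ℝ 1 v x‖ₑ ^ 2 < ⊤) (h2 : ∫⁻ x, ‖iteratedFDeriv ℝ 2 v x‖ₑ ^ 2 < ⊤)
    (hpos : 0 < M * Real.sqrt (Zen v) * Real.sqrt (Wpa v))
    (μ : Measure E3) [IsFiniteMeasure μ]
    (hμ : ∀ ψ : E3 → E3, ContDiff ℝ ∞ ψ → HasCompactSupport ψ → VectorCalculus.IsDivFree ψ →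
      Jst v * J1 v ψ - kStar ^ 2 * M ^ 2 * (Wpa v * A1 v ψ + Zen v * C1 v ψ) = ∫ x, ⟪v x, ψ x⟫_ℝ ∂μ)
    (hc : c ≠ 0) (hcM : ‖c‖ = M) (hL6 : MemLp (fun x => v x - c) 6 volume)
    {Rn : ℕ → ℝ} (hRn1 : ∀ n, 1 ≤ Rn n) (hRn : Tendsto Rn atTop atTop)
    {U : E3 → E3} (hU : AEStronglyMeasurable U volume) (hUl : LocallyIntegrable U volume)
    (hweak : ∀ Φ : E3 → E3, Continuous Φ → HasCompactSupport Φ →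
      Tendsto (fun n => ∫ x, ⟪Rn n • (v (Rn n • x) - c), Φ x⟫_ℝ) atTop (𝓝 (∫ x, ⟪U x, Φ x⟫_ℝ)))
    {C θ : ℝ} (hC : 0 ≤ C) (hθ0 : 0 ≤ θ) (hθ : θ < 3)
    (hA : ∀ L : ℝ, 1 ≤ L → ∫⁻ x in ball (0 : E3) L, ‖U x‖ₑ ^ 2 ≤ ENNReal.ofReal (C * L ^ θ))
    {K : Set E3} {e₀ : ℝ} (he₀ : 0 < e₀)
    (hlowK : ∀ n, ENNReal.ofReal e₀ ≤ ∫⁻ x in K, ‖Rn n • (v (Rn n • x) - c)‖ₑ ^ 2) :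
    ¬ Tendsto (fun n => ∫⁻ x in K, ‖Rn n • (v (Rn n • x) - c) - U x‖ₑ ^ 2) atTop (𝓝 0) := by
  intro hstrong
  have hU0 : U =ᵐ[volume] 0 :=
    blowDown_weakLimit_ae_eq_zero hv hdiv hM h1 h2 hpos μ hμ hc hcM hL6 hRn1 hRn hU hUl hweak hC hθ0 hθ hA
  have hge : ∀ n, ENNReal.ofReal e₀ ≤ ∫⁻ x in K, ‖Rn n • (v (Rn n • x) - c) - U x‖ₑ ^ 2 := by
    intro n
    have hae : (fun x => ‖Rn n • (v (Rn n • x) - c) - U x‖ₑ ^ 2) =ᵐ[volume.restrict K]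
        fun x => ‖Rn n • (v (Rn n • x) - c)‖ₑ ^ 2 := by
      filter_upwards [ae_restrict_of_ae hU0] with x hx
      rw [hx, Pi.zero_apply, sub_zero]
    rw [lintegral_congr_ae hae]
    exact hlowK n
  have hle : ENNReal.ofReal e₀ ≤ 0 := ge_of_tendsto' hstrong hge
  exact absurd (le_antisymm hle bot_le) (ENNReal.ofReal_pos.2 he₀).ne'

end ExtremiserLiouville

end Summit.NavierStokesRegularity.NavierStokesRegularity.Theorems

end
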